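import Summits.HubbardSuperconductivity.HubbardSuperconductivity.Theorems.CooperPairDMottWalkPlaquetteTables

/-!
# Route `CooperPairDMottWalk`, crux `CooperPairDMott`: the plaquette `d`-wave pair field in sector
# coordinates

Helper file for the stub `stub_plaquetteDWaveElement` of the line `Cruxes/CooperPairDMott/Lines/birth.lean`
(item stmt-HubbardSuperconductivity-1177; clauses 2 and 4 of the support item `PlaquettePairBinding`,
stmt-HubbardSuperconductivity-1181). The matrix element `⟨φ₂, Δ_d φ₄⟩` of the torus pair field
`Δ_d = pairField dWaveFormFactor 2` (PairCorrelations: `Σ_x Σ_{e ∈ {0, ±e₁, ±e₂}} (g_d(e)/√2)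
(c_{x↑} c_{x+e,↓} − c_{x↓} c_{x+e,↑})`, the neighbour `x + e` computed in `(ℤ/2ℤ)²`, so that on the
side-`2` torus `+e₁` and `−e₁` give the SAME neighbour and every plaquette bond is counted four
times) between a vector `φ₂` of the sector `(N↑, N↓) = (1,1)` and a vector `φ₄` of the sector
`(2,2)` of the `2 × 2` plaquette, written in Lieb's sector coordinates of the computable `Fin 4`
model of `…PlaquetteModel` / `…PlaquetteTables`:

* `pairOp4`: the same operator with sites pulled back along `siteEquiv : Fin 4 ≃ PlaquetteSite`;
  `relabel_pairOp4 : Γ pairOp4 Γᴴ = pairField dWaveFormFactor 2` (covariance of the CAR generators,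
  `relabel_annihilation`), hence `⟨φ₂, Δ_d φ₄⟩ = ⟨Γᴴ φ₂, pairOp4 Γᴴ φ₄⟩`
  (`star_dotProduct_pairField_mulVec`);
* `pairT`: the integer kernel `T_{ij,kl}` (a literal `4·4·6·6` table, checked against its
  definition `pairTDef` by `decide`) with
  `⟨ψ₂, pairOp4 ψ₄⟩ = (1/√2) Σ_{ijkl} conj W(ψ₂)_{ij} T_{ij,kl} W(ψ₄)_{kl}` for `ψ₂` in the sector
  `(1,1)` and `ψ₄` in the sector `(2,2)` (`star_dotProduct_pairOp4_mulVec`): the up/down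
  annihilation operators act on coefficient matrices by `W ↦ c_a P W c_bᵀ`, `W ↦ P c_b W c_aᵀ`
  (`TwoSpeciesCoordinates`), whose entries between the enumerated subsets are the integers `annInt`.

No new mathematics (Lieb, PRL 62 (1989) 1201, proof of Thm 1; Tasaki (2020) §9.2.1 for the
Jordan–Wigner signs); the table is a finite computation.
-/

set_option linter.dupNamespace false -- the route namespace `HubbardSuperconductivity.HubbardSuperconductivity` is mandated (D-0017)

noncomputable section

namespace Summit.HubbardSuperconductivity.HubbardSuperconductivity.Theorems.CooperPairDMottWalk

open Literature.MathematicalPhysics.QuantumLattice Literature.MathematicalPhysics.QuantumLattice.TwoSpecies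
open Literature.Probability.LatticeModels
open Matrix Finset

/-! ### The pair field pulled back to the `Fin 4` model -/

/-- The `d_{x²−y²}` form factor as an integer (`±e₁ ↦ 1`, `±e₂ ↦ −1`, else `0`). [folklore] -/
def dWaveInt (e : Site 2) : ℤ :=
  if e = Pi.single 0 1 ∨ e = -Pi.single 0 1 then 1
  else if e = Pi.single 1 1 ∨ e = -Pi.single 1 1 then -1 else 0

/-- `dWaveFormFactor` is the cast of `dWaveInt`. [folklore] -/
theorem dWaveFormFactor_eq_cast (e : Site 2) : dWaveFormFactor e = (dWaveInt e : ℝ) := by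
  unfold dWaveFormFactor dWaveInt
  split_ifs <;> simp

/-- The torus site `x ∈ (ℤ/2ℤ)²` read in the `Fin 4` model: `siteEquiv⁻¹ (ofTorusSite x)`. [folklore] -/
def site4 (x : TorusSite 2 2) : Fin 4 := siteEquiv.symm (FermionTorus.ofTorusSite x)

/-- `siteEquiv (site4 x) = ofTorusSite x`. [folklore] -/
theorem siteEquiv_site4 (x : TorusSite 2 2) : siteEquiv (site4 x) = FermionTorus.ofTorusSite x :=
  Equiv.apply_symm_apply _ _

/-- The singlet bond pair operator `c_{a↑} c_{b↓} − c_{a↓} c_{b↑}` of the `Fin 4` model. [folklore] -/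
def bondOp4 (a b : Fin 4) : Matrix (Finset (Orb (Fin 4))) (Finset (Orb (Fin 4))) ℂ :=
  annihilation (orb a 0) * annihilation (orb b 1) - annihilation (orb a 1) * annihilation (orb b 0)

/-- The torus pair field `pairField dWaveFormFactor 2` with its sites pulled back to `Fin 4`
(same sum over `x ∈ (ℤ/2ℤ)²` and `e ∈ {0, ±e₁, ±e₂}`, same coefficients `g_d(e)/√2`). [folklore] -/
def pairOp4 : Matrix (Finset (Orb (Fin 4))) (Finset (Orb (Fin 4))) ℂ :=
  ∑ x : TorusSite 2 2, ∑ e ∈ insert (0 : Site 2) unitSteps,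
    ((dWaveFormFactor e / Real.sqrt 2 : ℝ) : ℂ) • bondOp4 (site4 x) (site4 (x + Torus.proj 2 e))

/-- **`Γ pairOp4 Γᴴ = pairField dWaveFormFactor 2`** (the CAR generators are relabelled one by
one, `relabel_annihilation`). [folklore] -/
theorem relabel_pairOp4 : relabel orbEquiv pairOp4 = pairField dWaveFormFactor 2 := by
  simp only [pairOp4, bondOp4, pairField, localPair, relabel_sum, relabel_smul, relabel_sub,
    relabel_mul, relabel_annihilation, orbEquiv, Orb.mapEquiv_orb, siteEquiv_site4]

/-- **Transport of the matrix element**: `⟨φ₂, Δ_d φ₄⟩ = ⟨Γᴴ φ₂, pairOp4 (Γᴴ φ₄)⟩`. [folklore] -/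
theorem star_dotProduct_pairField_mulVec (φ₂ φ₄ : Fock (Orb PlaquetteSite)) :
    star φ₂ ⬝ᵥ (pairField dWaveFormFactor 2 *ᵥ φ₄) =
      star (gamᴴ *ᵥ φ₂) ⬝ᵥ (pairOp4 *ᵥ (gamᴴ *ᵥ φ₄)) := by
  conv_lhs => rw [← relabelMatrix_mulVec_conjTranspose_mulVec orbEquiv φ₄,
    ← relabelMatrix_mulVec_conjTranspose_mulVec orbEquiv φ₂, ← relabel_pairOp4,
    relabel_mulVec_relabelMatrix_mulVec, star_relabelMatrix_mulVec_dotProduct]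

/-! ### The integer kernel -/

/-- The integer kernel of `pairOp4` between the sector `(1,1)` (indices `i j : Fin 4` of `s1`) and
the sector `(2,2)` (indices `k l : Fin 6` of `s2`), as computed from the definitions:
`Σ_x Σ_e g_d(e) ((c_a)_{s1 i, s2 k} (c_b)_{s1 j, s2 l} + (c_b)_{s1 i, s2 k} (c_a)_{s1 j, s2 l})`,
`a = site4 x`, `b = site4 (x + e)`. [folklore] -/
def pairTDef (i j : Fin 4) (k l : Fin 6) : ℤ :=
  ∑ x : TorusSite 2 2, ∑ e ∈ insert (0 : Site 2) unitSteps,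
    dWaveInt e * (annInt (site4 x) (s1 i) (s2 k) * annInt (site4 (x + Torus.proj 2 e)) (s1 j) (s2 l) +
      annInt (site4 (x + Torus.proj 2 e)) (s1 i) (s2 k) * annInt (site4 x) (s1 j) (s2 l))

/-- The kernel `T_{ij,kl}` as a literal table (entries `0, ±4`: each plaquette bond is counted four
times, twice by orientation and twice by `±e`). [folklore] -/
def pairT : Fin 4 → Fin 4 → Fin 6 → Fin 6 → ℤ :=
  ![![![![0, 0, (-4), 0, 0, 0], ![0, 0, 4, 0, 0, 0], ![(-4), 4, 0, 0, 0, 0], ![0, 0, 0, 0, 0, 0], ![0, 0, 0, 0, 0, 0], ![0, 0, 0, 0, 0, 0]], ![![(-4), 0, 0, 0, (-4), 0], ![4, 0, 0, 0, 4, 0], ![0, 0, 0, 4, 0, 0], ![0, 0, 0, 0, 0, 0], ![0, 0, 0, 0, 0, 0], ![0, 0, 0, 0, 0, 0]], ![![0, (-4), 0, 0, 0, (-4)], ![0, 4, 0, 0, 0, 4], ![0, 0, 0, 4, 0, 0], ![0, 0, 0, 0, 0, 0], ![0, 0, 0, 0, 0, 0], ![0, 0, 0, 0, 0, 0]], ![![0,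 0, (-4), 0, 0, 0], ![0, 0, 4, 0, 0, 0], ![0, 0, 0, 0, 4, (-4)], ![0, 0, 0, 0, 0, 0], ![0, 0, 0, 0, 0, 0], ![0, 0, 0, 0, 0, 0]]],
    ![![![(-4), 4, 0, 0, 0, 0], ![0, 0, 0, 0, 0, 0], ![0, 0, 0, 0, 0, 0], ![0, 0, 4, 0, 0, 0], ![(-4), 4, 0, 0, 0, 0], ![0, 0, 0, 0, 0, 0]], ![![0, 0, 0, 4, 0, 0], ![0, 0, 0, 0, 0, 0], ![0, 0, 0, 0, 0, 0], ![4, 0, 0, 0, 4, 0], ![0, 0, 0, 4, 0, 0], ![0, 0, 0, 0, 0, 0]], ![![0, 0, 0, 4, 0, 0], ![0, 0, 0, 0, 0, 0], ![0, 0, 0, 0, 0, 0], ![0, 4, 0, 0, 0, 4], ![0, 0, 0, 4, 0, 0], ![0, 0, 0, 0, 0, 0]], ![![0, 0, 0, 0, 4, (-4)], ![0, 0, 0, 0, 0, 0], ![0, 0, 0, 0, 0, 0], ![0, 0, 4, 0, 0, 0], ![0, 0, 0, 0, 4, (-4)], ![0, 0, 0, 0, 0, 0]]],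
    ![![![0, 0, 0, 0, 0, 0], ![(-4), 4, 0, 0, 0, 0], ![0, 0, 0, 0, 0, 0], ![0, 0, 4, 0, 0, 0], ![0, 0, 0, 0, 0, 0], ![(-4), 4, 0, 0, 0, 0]], ![![0, 0, 0, 0, 0, 0], ![0, 0, 0, 4, 0, 0], ![0, 0, 0, 0, 0, 0], ![4, 0, 0, 0, 4, 0], ![0, 0, 0, 0, 0, 0], ![0, 0, 0, 4, 0, 0]], ![![0, 0, 0, 0, 0, 0], ![0, 0, 0, 4, 0, 0], ![0, 0, 0, 0, 0, 0], ![0, 4, 0, 0, 0, 4], ![0, 0, 0, 0, 0, 0], ![0, 0, 0, 4, 0, 0]], ![![0, 0, 0, 0, 0, 0], ![0, 0, 0, 0, 4, (-4)], ![0, 0, 0, 0, 0, 0], ![0, 0, 4, 0, 0, 0], ![0, 0, 0, 0, 0, 0], ![0, 0, 0, 0, 4, (-4)]]],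
    ![![![0, 0, 0, 0, 0, 0], ![0, 0, 0, 0, 0, 0], ![(-4), 4, 0, 0, 0, 0], ![0, 0, 0, 0, 0, 0], ![0, 0, 4, 0, 0, 0], ![0, 0, (-4), 0, 0, 0]], ![![0, 0, 0, 0, 0, 0], ![0, 0, 0, 0, 0, 0], ![0, 0, 0, 4, 0, 0], ![0, 0, 0, 0, 0, 0], ![4, 0, 0, 0, 4, 0], ![(-4), 0, 0, 0, (-4), 0]], ![![0, 0, 0, 0, 0, 0], ![0, 0, 0, 0, 0, 0], ![0, 0, 0, 4, 0, 0], ![0, 0, 0, 0, 0, 0], ![0, 4, 0, 0, 0, 4], ![0, (-4), 0, 0, 0, (-4)]], ![![0, 0, 0, 0, 0, 0], ![0, 0, 0, 0, 0, 0], ![0, 0, 0, 0, 4, (-4)], ![0, 0, 0, 0, 0, 0], ![0, 0, 4, 0, 0, 0], ![0, 0, (-4), 0, 0, 0]]]]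

/-- The table `pairT` is the kernel `pairTDef` (kernel evaluation). [folklore] -/
theorem pairTDef_eq : ∀ i j k l, pairTDef i j k l = pairT i j k l := by decide +kernel

/-! ### The bond operators on coefficient matrices -/

/-- Entry `(s1 i, s1 j)` of `c_a P W c_bᵀ` for `W` supported on `2`-subsets × `2`-subsets. [folklore] -/
theorem ann_upParity_W_annT_apply {ψ : Fock (Orb (Fin 4))} (hψ : IsInSector 2 2 ψ) (a b i j : Fin 4) :
    (annihilation a * (upParity * coeffMatrix ψ * (annihilation b)ᵀ) :
        Matrix (Finset (Fin 4)) (Finset (Fin 4)) ℂ) (s1 i) (s1 j) =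
      ∑ k, ∑ l, ((annInt a (s1 i) (s2 k) * annInt b (s1 j) (s2 l) : ℤ) : ℂ) * w22 ψ k l := by
  have hW := (isInSector_iff_coeffMatrix 2 2 ψ).1 hψ
  rw [Matrix.mul_apply]
  -- restrict the sum over `γ` to `2`-subsets
  rw [isSubsetEnum_s2.sum_eq _ fun γ hγ => ?_]
  · refine Finset.sum_congr rfl fun k _ => ?_
    rw [Matrix.mul_apply, Finset.mul_sum, isSubsetEnum_s2.sum_eq _ fun δ hδ => ?_]
    · refine Finset.sum_congr rfl fun l _ => ?_
      rw [upParity_mul_apply, transpose_apply, isSubsetEnum_s2.card_eq, annihilation_eq_cast,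
        annihilation_eq_cast, w22]
      push_cast
      ring
    · rw [upParity_mul_apply, hW _ _ fun h => hδ h.2, mul_zero, zero_mul, mul_zero]
  · rw [Matrix.mul_apply, Finset.sum_eq_zero fun δ _ => ?_, mul_zero]
    rw [upParity_mul_apply, hW _ _ fun h => hγ h.1, mul_zero, zero_mul]

/-- Entry `(s1 i, s1 j)` of `P c_b W c_aᵀ` for `W` supported on `2`-subsets × `2`-subsets
(`P = −1` on one-element rows). [folklore] -/
theorem upParity_ann_W_annT_apply {ψ : Fock (Orb (Fin 4))} (hψ : IsInSector 2 2 ψ) (a b i j : Fin 4) :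
    (upParity * (annihilation b * coeffMatrix ψ) * (annihilation a)ᵀ :
        Matrix (Finset (Fin 4)) (Finset (Fin 4)) ℂ) (s1 i) (s1 j) =
      -∑ k, ∑ l, ((annInt b (s1 i) (s2 k) * annInt a (s1 j) (s2 l) : ℤ) : ℂ) * w22 ψ k l := by
  have hW := (isInSector_iff_coeffMatrix 2 2 ψ).1 hψ
  have hcard : (s1 i).card = 1 := isSubsetEnum_s1.card_eq i
  rw [Matrix.mul_apply, isSubsetEnum_s2.sum_eq _ fun δ hδ => ?_]
  · have key : ∀ l, (upParity * (annihilation b * coeffMatrix ψ) :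
          Matrix (Finset (Fin 4)) (Finset (Fin 4)) ℂ) (s1 i) (s2 l) * (annihilation a)ᵀ (s2 l) (s1 j) =
        -∑ k, ((annInt b (s1 i) (s2 k) * annInt a (s1 j) (s2 l) : ℤ) : ℂ) * w22 ψ k l := by
      intro l
      rw [upParity_mul_apply, transpose_apply, hcard, pow_one, Matrix.mul_apply,
        isSubsetEnum_s2.sum_eq _ fun γ hγ => ?_]
      · rw [Finset.mul_sum, Finset.sum_mul, ← Finset.sum_neg_distrib]
        refine Finset.sum_congr rfl fun k _ => ?_
        rw [annihilation_eq_cast, annihilation_eq_cast, w22]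
        push_cast
        ring
      · rw [hW _ _ fun h => hγ h.1, mul_zero]
    simp_rw [key]
    rw [Finset.sum_neg_distrib, Finset.sum_comm]
  · rw [upParity_mul_apply, Matrix.mul_apply, Finset.sum_eq_zero fun γ _ => ?_, mul_zero, zero_mul]
    rw [hW _ _ fun h => hδ h.2, mul_zero]

/-- **The bond operator on coefficient matrices**: for `ψ` in the sector `(2,2)`,
`W((c_{a↑} c_{b↓} − c_{a↓} c_{b↑}) ψ)_{s1 i, s1 j} = Σ_{kl} ((c_a)_{i,k} (c_b)_{j,l} + (c_b)_{i,k} (c_a)_{j,l}) W(ψ)_{kl}`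
(`W(c_{x↑} ψ) = c_x W`, `W(c_{x↓} ψ) = P W c_xᵀ`). [folklore] -/
theorem coeffMatrix_bondOp4_mulVec {ψ : Fock (Orb (Fin 4))} (hψ : IsInSector 2 2 ψ) (a b i j : Fin 4) :
    coeffMatrix (bondOp4 a b *ᵥ ψ) (s1 i) (s1 j) =
      ∑ k, ∑ l, ((annInt a (s1 i) (s2 k) * annInt b (s1 j) (s2 l) +
        annInt b (s1 i) (s2 k) * annInt a (s1 j) (s2 l) : ℤ) : ℂ) * w22 ψ k l := by
  rw [bondOp4, sub_mulVec, ← mulVec_mulVec, ← mulVec_mulVec, coeffMatrix_sub,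
    coeffMatrix_annihilation_up_mulVec, coeffMatrix_annihilation_down_mulVec,
    coeffMatrix_annihilation_down_mulVec, coeffMatrix_annihilation_up_mulVec, Matrix.sub_apply,
    ann_upParity_W_annT_apply hψ, upParity_ann_W_annT_apply hψ, sub_neg_eq_add,
    ← Finset.sum_add_distrib]
  refine Finset.sum_congr rfl fun k _ => ?_
  rw [← Finset.sum_add_distrib]
  refine Finset.sum_congr rfl fun l _ => ?_
  push_cast
  ring

/-- The coefficient `g_d(e)/√2` factors as `(1/√2) · dWaveInt e`. [folklore] -/
theorem dWave_coeff_eq (e : Site 2) :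
    ((dWaveFormFactor e / Real.sqrt 2 : ℝ) : ℂ) = ((1 / Real.sqrt 2 : ℝ) : ℂ) * (dWaveInt e : ℂ) := by
  rw [dWaveFormFactor_eq_cast]
  push_cast
  ring

/-- Reordering of a fourfold sum (the second index over a fixed finset). [folklore] -/
theorem sum_four_comm {α β γ δ M : Type*} [Fintype α] [Fintype γ] [Fintype δ] [AddCommMonoid M]
    (S : Finset β) (f : α → β → γ → δ → M) :
    ∑ a, ∑ b ∈ S, ∑ c, ∑ d, f a b c d = ∑ c, ∑ d, ∑ a, ∑ b ∈ S, f a b c d :=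
  calc ∑ a, ∑ b ∈ S, ∑ c, ∑ d, f a b c d = ∑ a, ∑ c, ∑ b ∈ S, ∑ d, f a b c d :=
        Finset.sum_congr rfl fun _ _ => Finset.sum_comm
    _ = ∑ c, ∑ a, ∑ b ∈ S, ∑ d, f a b c d := Finset.sum_comm
    _ = ∑ c, ∑ a, ∑ d, ∑ b ∈ S, f a b c d :=
        Finset.sum_congr rfl fun _ _ => Finset.sum_congr rfl fun _ _ => Finset.sum_comm
    _ = ∑ c, ∑ d, ∑ a, ∑ b ∈ S, f a b c d := Finset.sum_congr rfl fun _ _ => Finset.sum_comm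

/-- **`pairOp4` on coefficient matrices**: for `ψ` in the sector `(2,2)`,
`W(pairOp4 ψ)_{s1 i, s1 j} = (1/√2) Σ_{kl} T_{ij,kl} W(ψ)_{kl}`. [folklore] -/
theorem coeffMatrix_pairOp4_mulVec {ψ : Fock (Orb (Fin 4))} (hψ : IsInSector 2 2 ψ) (i j : Fin 4) :
    coeffMatrix (pairOp4 *ᵥ ψ) (s1 i) (s1 j) =
      ((1 / Real.sqrt 2 : ℝ) : ℂ) * ∑ k, ∑ l, (pairT i j k l : ℂ) * w22 ψ k l := by
  simp only [pairOp4, Matrix.sum_mulVec, Matrix.smul_mulVec, coeffMatrix_sum, coeffMatrix_smul,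
    Matrix.sum_apply, Matrix.smul_apply, smul_eq_mul, coeffMatrix_bondOp4_mulVec hψ, dWave_coeff_eq,
    ← pairTDef_eq, pairTDef]
  push_cast
  simp only [Finset.mul_sum, Finset.sum_mul]
  rw [sum_four_comm]
  refine Finset.sum_congr rfl fun k _ => Finset.sum_congr rfl fun l _ =>
    Finset.sum_congr rfl fun x _ => Finset.sum_congr rfl fun e _ => ?_
  ring

/-- **The matrix element in sector coordinates**: for `ψ₂` in the sector `(1,1)` and `ψ₄` in the
sector `(2,2)` of the `Fin 4` model,
`⟨ψ₂, pairOp4 ψ₄⟩ = (1/√2) Σ_{ijkl} conj W(ψ₂)_{ij} T_{ij,kl} W(ψ₄)_{kl}`. [folklore] -/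
theorem star_dotProduct_pairOp4_mulVec {ψ₂ ψ₄ : Fock (Orb (Fin 4))} (h₂ : IsInSector 1 1 ψ₂)
    (h₄ : IsInSector 2 2 ψ₄) :
    star ψ₂ ⬝ᵥ (pairOp4 *ᵥ ψ₄) = ((1 / Real.sqrt 2 : ℝ) : ℂ) *
      ∑ i, ∑ j, ∑ k, ∑ l, star (w11 ψ₂ i j) * (pairT i j k l : ℂ) * w22 ψ₄ k l := by
  rw [sector_star_dotProduct isSubsetEnum_s1 isSubsetEnum_s1 h₂, Finset.mul_sum]
  refine Finset.sum_congr rfl fun i _ => ?_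
  rw [Finset.mul_sum]
  refine Finset.sum_congr rfl fun j _ => ?_
  rw [coeffMatrix_pairOp4_mulVec h₄, w11, Finset.mul_sum, Finset.mul_sum, Finset.mul_sum]
  refine Finset.sum_congr rfl fun k _ => ?_
  rw [Finset.mul_sum, Finset.mul_sum, Finset.mul_sum]
  refine Finset.sum_congr rfl fun l _ => ?_
  ring

/-! ### Registered sub-goal of the crux item (stmt-HubbardSuperconductivity-1177) -/

/-- Registered sub-goal `dWaveElement_bondOpCoeff` of the crux item: the singlet bond pair operator in sector coordinates (`coeffMatrix_bondOp4_mulVec`, restated with `bondOp4` unfolded). [folklore] -/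
theorem dWaveElement_bondOpCoeff : ∀ {ψ : Fock (Orb (Fin 4))}, IsInSector 2 2 ψ → ∀ a b i j : Fin 4, Literature.MathematicalPhysics.QuantumLattice.TwoSpecies.coeffMatrix ((annihilation (orb a 0) * annihilation (orb b 1) - annihilation (orb a 1) * annihilation (orb b 0)) *ᵥ ψ) (Summit.HubbardSuperconductivity.HubbardSuperconductivity.Theorems.CooperPairDMottWalk.s1 i) (Summit.HubbardSuperconductivity.HubbardSuperconductivity.Theorems.CooperPairDMottWalk.s1 j) = ∑ k, ∑ l, ((Literature.MathematicalPhysics.QuantumLattice.TwoSpecies.annInt a (Summit.HubbardSuperconductivity.HubbardSuperconductivity.Theorems.CooperPairDMottWalk.s1 i) (Summit.HubbardSuperconductivity.HubbardSuperconductivity.Theorems.CooperPairDMottWalk.s2 k) * Literature.MathematicalPhysics.QuantumLattice.TwoSpecies.annInt b (Summit.HubbardSuperconductivity.HubbardSuperconductivity.Theorems.CooperPairDMottWalk.s1 j) (Summit.HubbardSuperconductivity.HubbardSuperconductivity.Theorems.CooperPairDMottWalk.s2 l) + Literature.MathematicalPhysics.QuantumLattice.TwoSpecies.annInt b (Summit.HubbardSuperconductivity.HubbardSuperconductivity.Theorems.CooperPairDMottWalk.s1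 i) (Summit.HubbardSuperconductivity.HubbardSuperconductivity.Theorems.CooperPairDMottWalk.s2 k) * Literature.MathematicalPhysics.QuantumLattice.TwoSpecies.annInt a (Summit.HubbardSuperconductivity.HubbardSuperconductivity.Theorems.CooperPairDMottWalk.s1 j) (Summit.HubbardSuperconductivity.HubbardSuperconductivity.Theorems.CooperPairDMottWalk.s2 l) : ℤ) : ℂ) * Summit.HubbardSuperconductivity.HubbardSuperconductivity.Theorems.CooperPairDMottWalk.w22 ψ k l :=
  fun hψ a b i j => coeffMatrix_bondOp4_mulVec hψ a b i j

end Summit.HubbardSuperconductivity.HubbardSuperconductivity.Theorems.CooperPairDMottWalk
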